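import Summits.QuantumFields.YangMills.Theorems.BalabanUVNodesN27SpineRecordJoin

/-!
# BalabanUVNodes ∕ N27 spine-record join, II — B5 at the datum WITH N17 ITSELF BY NAME (`Spine.NE4.NE4OnData D`), the edge
# N17 → N27 produced in kernel by dag-n17-a's `N17Knit.nodeU2_of_N17` (companion of `BalabanUVNodesN27SpineRecordJoin`, split
# for the 400-line limit; cell `pub-ymgap`, HUMAN RULING D-0062 Track A, seat `pub-ymgap-dag-n27-a` g2; `--supports
# stmt-QuantumFields-19182`, count-neutral)

HONEST FRAMING.  As in the companion: COMPOSITE-node bookkeeping BY NAME over hypothesis shapes of the tree (NE3, NE4, NE5, NE9, NE7b, NE7c —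
none printed for Bałaban's d = 4 procedure, none proved; the ledger link is NODE O content; N17's companions `NE4.LocalAnalyticRel` ∕
`BetaUpperH` are UNPRINTED as uniform statements); nothing of Bałaban's instantiated; NO node discharged; one fixed finite four-torus —
NOT ℝ⁴, NOT infinite volume, NOT OS, NOT a mass gap, NOT Clay.  0 `def`, 0 `sorry`, standard axioms.  With this theorem the composite
binder B5 = `T4ApexHybrid.HybridNE7Under D Hβ` is concluded AT ANY DATUM from: N16 · N17 · N18 · N22 as TOP-LEVEL statements of record,
N20 · N21 · E1∕E2 under the targets' prefix at per-string carriers, the run clauses and the (2.25)-ledger link at the datum's own runs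
`Spine.NE4.runFlow D g₀`, and N17's regularity∕β-side companions — the field-by-field table of the companion's header says which of
these is a theorem today (at D₀: none of the six estimates; all knits count-neutral).
Printed context = LOCATIONS only: [Balaban1987RG1] CMP **109** (0.20) p. 256, Thm 2 p. 259, p. 264 (the last-coupling regularity TYPE);
[King1986] CMP **102** (3.9)–(3.13) pp. 656–657 (templates).  No decl below carries a cite tag.
-/

open Finset MeasureTheory

namespace Summit.QuantumFields.YangMills.Theorems.BalabanUVNodesN27SpineRecord

open Literature.MathematicalPhysics.QuantumFieldTheory.Balaban1983to89
open Literature.MathematicalPhysics.QuantumFieldTheory.Balaban1983to89.T4Continuum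
open T4OutputRate T4RecentScale T4GoodClassBudget T4CauchySum T4TowerRateComposition T4TowerRateDischarge T4TermwiseBudget
open T4WeightBudget (RelWeightBound)
open T4IndicatorShell (ShellWeightBound)
open T4EtaRateMin (Readings NE3Shape)
open T4RateLiaison (GaugeDominated)
open Summit.QuantumFields.BalabanUV.T4Continuum.Spine
open Summit.QuantumFields.BalabanUV.T4Continuum.Spine.NE4 (NE4OnData U2Output runFlow)

section Datum

variable {F : T4Family} {G : Type*} [GaugeGroup G] [MeasurableSpace G] [HaarData G]
  {C : Carriers} {ι X : Type} [MeasurableSpace ι] {σ : Type} [DecidableEq σ]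
  -- string-independent K4 data (the record decls' own letters)
  {R : Readings ι X} {Wset : Set (ℕ → ℝ)} {EA : Functional C C.BgA} {EB : Functional C C.BgB}
  {κ θ₅ C₅ C₉ ω C₃ θ₃ P θ' Cw a Λ E₀ : ℝ} {q m : ℕ} {Λm : ℕ → ℕ → ℝ} {CU : (ℕ → ℝ) → ℕ → ℝ}
  {uA : ℕ → ι → C.BgA} {uB : ℕ → ι → C.BgB} {oneA : C.BgA} {oneB : C.BgB}
  -- per-(tuned sequence, string) K5 ∕ ledger carriers
  {l₀ vol : (ℕ → ℝ) → List (ULoop F) → ℝ} {K₀ : (ℕ → ℝ) → List (ULoop F) → ℕ}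
  {T : (ℕ → ℝ) → List (ULoop F) → ℕ → Finset σ} {Bad : (ℕ → ℝ) → List (ULoop F) → ℕ → ℝ → Finset σ}
  {A B shA shB : (ℕ → ℝ) → List (ULoop F) → ℕ → ℝ → σ → ℝ} {W Wsh rO : (ℕ → ℝ) → List (ULoop F) → ℕ → ℝ}
  {μ : (ℕ → ℝ) → List (ULoop F) → ℕ → ℝ → σ → Measure ι} {fac : (ℕ → ℝ) → List (ULoop F) → ℕ → ℝ → σ → Finset C.Dom}
  {oA oB : (ℕ → ℝ) → List (ULoop F) → ℕ → ℝ → σ → ι → ℝ} {κ₁ Ssz : (ℕ → ℝ) → List (ULoop F) → ℕ → ℝ → σ → ℕ → ℝ}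
  {cO RO : (ℕ → ℝ) → List (ULoop F) → ℕ → ℝ → σ → ℝ}

/-- **N27 = B5 AT THE DATUM WITH N17 ITSELF BY NAME** — the same join with the edge N17 → N27 PRODUCED IN KERNEL by dag-n17-a's
`N17Knit.nodeU2_of_N17` (`Spine.NE4.MinimalInterface.nodeU2_minimal`): from N17's statement of record ON THE DATUM `hN17 : Spine.NE4.NE4OnData D c₄ θ₄ γᵤ`
(`= ScaleShiftRate c₄ θ₄ γᵤ D.βfun`), relative real-analytic charts of the real one-coupling β-sections `NE4.LocalAnalyticRel B₄ γᵤ ρ₄ D.βfun`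
(printed TYPE for the last coupling, [Balaban1987RG1] p. 264; uniformity UNPRINTED), the printed-type upper bound `BetaUpperH β₁ γᵤ D.βfun` with
`γᵤ²β₁ < 1` (so (0.20) runs forward along tuned runs) and rates `θ₄ < θ₄′ < ρ₄′ < 1`, node U2's output under the prefix is
`U2Output D g₀ (2c₄∕(1−ρ₄′)) ρ₄′`; the rest as in `hybridNE7Under_of_spineRecordAtDatum` with `Cd := 2c₄∕(1−ρ₄′)`, `θc := ρ₄′`.  So B5 at `D`
follows from the record decls N16 · N17 · N18 · N22 (top level, by name) · N20 · N21 (under the prefix) · E1∕E2 · the run clauses · the ledger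
link · N17's regularity∕β-side companions.  On n17-a's OTHER road (`u2Output_under_of_u3edge`: (D4) read-outs ∧ N18's b-family ∧ N22 ∧
`EventualLowerH` ∧ `BetaUpperH` ∧ window smallness) feed its conclusion to `hybridNE7Under_of_spineRecordAtDatum` directly.  CONDITIONAL on every
binder; NOT a discharge. [bookkeeping] [folklore] -/
theorem hybridNE7Under_of_spineRecordAtDatum_of_N17 (D : FiniteEpsData F G) {Hβ : Prop}
    {c₄ θ₄ γu B₄ ρ₄ β₁ θ₄' ρ₄' : ℝ}
    -- N17 BY NAME on the datum, with the companions of `N17Knit.nodeU2_of_N17`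
    (hN17 : NE4OnData D c₄ θ₄ γu) (hLA : NE4.LocalAnalyticRel B₄ γu ρ₄ D.βfun)
    (hhi : FlowStep.BetaUpperH β₁ γu D.βfun) (hγβ : γu ^ 2 * β₁ < 1)
    (hc₄ : 0 ≤ c₄) (hθ₄0 : 0 < θ₄) (hθ₄1 : θ₄ < 1) (hB₄ : 0 < B₄) (hρ₄ : 0 < ρ₄) (hρ₄1 : ρ₄ ≤ 1) (hγu : 0 < γu)
    (hθθ' : θ₄ < θ₄') (hθ'ρ' : θ₄' < ρ₄') (hρ'1 : ρ₄' < 1)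
    -- K4 record decls, string-independent, BY NAME
    (h16 : NE3Shape R C₃ θ₃) (hC₃ : 0 ≤ C₃) (hgd : GaugeDominated R uA uB)
    (h18 : NE5 EA EB Wset κ θ₅ C₅) (hθ₅ : 0 ≤ θ₅) (hC₅ : 0 ≤ C₅)
    (h22 : NE9 EA Wset κ Λm ∧ FadingMemory C₉ ω Λm) (hω : 0 ≤ ω)
    (hUL : LipBackground EA Wset κ CU) (hP : 0 ≤ P)
    (hθ' : max ω ρ₄' < θ') (hθ₅' : θ₅ ≤ θ') (hθ₃' : θ₃ ≤ θ') (hθ'1 : θ' < 1) (hθ'Λ : θ' ≤ Λ)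
    (hE₀ : 0 ≤ E₀) (ha0 : 0 < a) (ha1 : a < 1)
    -- K5 per string, the run clauses, the ledger link (as in `hybridNE7Under_of_spineRecordAtDatum`)
    (hK5 : D.UnderHypotheses Hβ fun g₀ => ∀ os : List (ULoop F),
      0 < l₀ g₀ os ∧ 0 < vol g₀ os ∧
        RelWeightBound (l₀ g₀ os) (T g₀ os) (A g₀ os) (B g₀ os) (Bad g₀ os) (W g₀ os) ∧
        ShellWeightBound (l₀ g₀ os) (T g₀ os) (A g₀ os) (B g₀ os) (shA g₀ os) (shB g₀ os) (Wsh g₀ os) ∧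
        (∀ K, W g₀ os K + Wsh g₀ os K < 1) ∧
        (∀ (K : ℕ) (t : ℝ), |t| ≤ l₀ g₀ os →
          T4GenFunBounds.schemeZ (D.scheme g₀) os (K₀ g₀ os + K) t = ∑ τ ∈ T g₀ os K, A g₀ os K t τ) ∧
        (∀ (K : ℕ) (t : ℝ), |t| ≤ l₀ g₀ os →
          T4GenFunBounds.schemeZ (D.scheme g₀) os (K₀ g₀ os + K + 1) t = ∑ τ ∈ T g₀ os K, B g₀ os K t τ))
    -- the run-dependent K4 clauses at the datum's runs
    (hRuns : D.UnderHypotheses Hβ fun g₀ => ∀ os : List (ULoop F),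
      PolyLipGrowth CU (fun K => runFlow D g₀ (K₀ g₀ os + K)) P q ∧
        (∀ K, runFlow D g₀ (K₀ g₀ os + K) ∈ Wset) ∧
        (∀ K, (fun i => runFlow D g₀ (K₀ g₀ os + (K + 1)) (i + 1)) ∈ Wset))
    -- the (2.25)-ledger link at the datum's runs
    (hLink : D.UnderHypotheses Hβ fun g₀ => ∀ os : List (ULoop F),
      (∀ K t τ, A g₀ os K t τ - shA g₀ os K t τ = ∫ v, (∏ Y ∈ fac g₀ os K t τ,
        Real.exp (EA (runFlow D g₀ (K₀ g₀ os + K)) (uA K v) Y - EA (runFlow D g₀ (K₀ g₀ os + K)) oneA Y)) *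
          oA g₀ os K t τ v ∂(μ g₀ os K t τ)) ∧
      (∀ K t τ, B g₀ os K t τ - shB g₀ os K t τ = ∫ v, (∏ Y ∈ fac g₀ os K t τ,
        Real.exp (EB (fun i => runFlow D g₀ (K₀ g₀ os + (K + 1)) (i + 1)) (uB K v) Y
          - EB (fun i => runFlow D g₀ (K₀ g₀ os + (K + 1)) (i + 1)) oneB Y)) * oB g₀ os K t τ v ∂(μ g₀ os K t τ)) ∧
      (∀ K t, |t| ≤ l₀ g₀ os → ∀ τ ∈ T g₀ os K \ Bad g₀ os K t,
        Integrable (fun v => (∏ Y ∈ fac g₀ os K t τ,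
          Real.exp (EA (runFlow D g₀ (K₀ g₀ os + K)) (uA K v) Y - EA (runFlow D g₀ (K₀ g₀ os + K)) oneA Y)) *
            oA g₀ os K t τ v) (μ g₀ os K t τ) ∧
        Integrable (fun v => (∏ Y ∈ fac g₀ os K t τ,
          Real.exp (EB (fun i => runFlow D g₀ (K₀ g₀ os + (K + 1)) (i + 1)) (uB K v) Y
            - EB (fun i => runFlow D g₀ (K₀ g₀ os + (K + 1)) (i + 1)) oneB Y)) * oB g₀ os K t τ v) (μ g₀ os K t τ)) ∧
      (∀ K t, |t| ≤ l₀ g₀ os → ∀ τ ∈ T g₀ os K \ Bad g₀ os K t, ∀ Y ∈ fac g₀ os K t τ, C.scale Y ≤ K) ∧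
      (∀ K t, |t| ≤ l₀ g₀ os → ∀ τ ∈ T g₀ os K \ Bad g₀ os K t, ∀ v ∈ R.dom,
        0 < oA g₀ os K t τ v ∧ 0 < oB g₀ os K t τ v) ∧
      (∀ K t, |t| ≤ l₀ g₀ os → ∀ τ ∈ T g₀ os K \ Bad g₀ os K t, ∀ v, v ∉ R.dom →
        (∏ Y ∈ fac g₀ os K t τ,
          Real.exp (EA (runFlow D g₀ (K₀ g₀ os + K)) (uA K v) Y - EA (runFlow D g₀ (K₀ g₀ os + K)) oneA Y)) *
            oA g₀ os K t τ v = 0 ∧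
        (∏ Y ∈ fac g₀ os K t τ,
          Real.exp (EB (fun i => runFlow D g₀ (K₀ g₀ os + (K + 1)) (i + 1)) (uB K v) Y
            - EB (fun i => runFlow D g₀ (K₀ g₀ os + (K + 1)) (i + 1)) oneB Y)) * oB g₀ os K t τ v = 0) ∧
      (∀ K t, |t| ≤ l₀ g₀ os → ∀ τ ∈ T g₀ os K \ Bad g₀ os K t, ∀ v ∈ R.dom, ∀ j ≤ K,
        |(∑ Y ∈ fac g₀ os K t τ with C.scale Y = j,
            (Real.log (Real.exp (EB (fun i => runFlow D g₀ (K₀ g₀ os + (K + 1)) (i + 1)) (uB K v) Y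
                - EB (fun i => runFlow D g₀ (K₀ g₀ os + (K + 1)) (i + 1)) oneB Y))
              - Real.log (Real.exp (EA (runFlow D g₀ (K₀ g₀ os + K)) (uA K v) Y
                - EA (runFlow D g₀ (K₀ g₀ os + K)) oneA Y)))) - κ₁ g₀ os K t τ j| ≤ Ssz g₀ os K t τ j) ∧
      (∀ K t, |t| ≤ l₀ g₀ os → ∀ τ ∈ T g₀ os K \ Bad g₀ os K t,
        Multiplicity (fac g₀ os K t τ) C.scale (fun Y => Real.exp (-(κ * C.d Y))) Cw (vol g₀ os) Λ K) ∧
      (∀ K t, |t| ≤ l₀ g₀ os → ∀ τ ∈ T g₀ os K \ Bad g₀ os K t, ∀ v ∈ R.dom,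
        |Real.log (oB g₀ os K t τ v) - Real.log (oA g₀ os K t τ v) - cO g₀ os K t τ| ≤ RO g₀ os K t τ) ∧
      (∀ K t, |t| ≤ l₀ g₀ os → ∀ τ ∈ T g₀ os K \ Bad g₀ os K t, ∀ j ≤ K,
        Ssz g₀ os K t τ j ≤ vol g₀ os * (E₀ * ((K : ℝ) + 1) ^ m * a ^ (K - j))) ∧
      (∀ K t, |t| ≤ l₀ g₀ os → ∀ τ ∈ T g₀ os K \ Bad g₀ os K t, RO g₀ os K t τ ≤ vol g₀ os * rO g₀ os K) ∧
      Summable (rO g₀ os) ∧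
      (∀ Cr : ℝ, 0 ≤ Cr → ∃ c₀ s : ℕ → ℝ, Summable s ∧ ∀ K t, |t| ≤ l₀ g₀ os → ∀ τ ∈ T g₀ os K \ Bad g₀ os K t,
        |((∑ j ∈ range (K + 1), sliceCentre (κ₁ g₀ os K t τ)
            (fun j => ∑ Y ∈ fac g₀ os K t τ with C.scale Y = j,
              (-(EB (fun i => runFlow D g₀ (K₀ g₀ os + (K + 1)) (i + 1)) oneB Y
                - EA (runFlow D g₀ (K₀ g₀ os + K)) oneA Y)))
            (Ssz g₀ os K t τ) (fun j => Cw * vol g₀ os * (Cr * θ' ^ j * Λ ^ (K - j))) j) + cO g₀ os K t τ) - c₀ K|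
          ≤ vol g₀ os * s K)) :
    T4ApexHybrid.HybridNE7Under D Hβ :=
  have hU2 : D.UnderHypotheses Hβ fun g₀ => U2Output D g₀ (2 * c₄ / (1 - ρ₄')) ρ₄' :=
    (BalabanUVNodesN17.nodeU2_of_N17 D (cc := fun _ => True) hN17 hLA hhi hγβ hc₄ hθ₄0 hθ₄1 hB₄ hρ₄ hρ₄1 hγu hθθ'
      hθ'ρ' hρ'1).1
  hybridNE7Under_of_spineRecordAtDatum D h16 hC₃ hgd h18 hθ₅ hC₅ h22 hω hUL hP hθ' hθ₅' hθ₃' hθ'1 hθ'Λ hE₀ ha0 ha1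
    (div_nonneg (mul_nonneg zero_le_two hc₄) (by linarith)) (by linarith) hU2 hK5 hRuns hLink

end Datum

end Summit.QuantumFields.YangMills.Theorems.BalabanUVNodesN27SpineRecord
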